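import Literature.Topology.FourManifolds.MazurDoubleReductionProofs
import Literature.Topology.FourManifolds.HCobordismTheoremProofs
import Literature.Topology.FourManifolds.DisjointSpheresSlab
import Literature.Topology.FourManifolds.MorseDiscLemma
import Literature.Topology.FourManifolds.SPC4HandlesCancelStep
import Literature.Topology.FourManifolds.GradientLikeExistence
import HarnessLib

/-!
# Mazur doubles, IV: Mazur's cancellation of the `1`- and the `2`-handle of `W × I`, in Morse form

Companion of `MazurDouble.lean` (the named fact `Mazur1961_double_sphere_four`: the double of a
compact contractible `4`-manifold with one handle of each index `0, 1, 2` is `S⁴`),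
`MazurDoubleReduction.lean` / `MazurDoubleReductionProofs.lean` (Mazur's theorem from the level
presentation (B) and the Andrews–Curtis fact (AC), both still open in the tree) and
`DoubleThickeningProofs.lean` (the counted thickening `V⁵` of a double, proved).

This file opens a second, purely Morse-theoretic road to Mazur's theorem which uses neither (B)
nor (AC): Mazur's own argument (Mazur 1961, proof of the Theorem `W × I ≅ I⁵`: *"the 1-handle and
the 2-handle of `W × I` cancel"*), run with Milnor's First Cancellation Theorem (Milnor 1965,
Thm. 5.4, a theorem of the tree, `Cobordism.Milnor1965_firstCancellation_slab_holds`) on the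
compact contractible `5`-manifold `V` with one critical point of each index `0, 1, 2` supplied by
the counted thickening.  Everything here is **proved**; no definition and no named fact is
introduced.  The one remaining input — that the right-hand `3`-sphere of the index-`1` point `p`
and the left-hand circle of the index-`2` point `q` can be brought, by a change of the
gradient-like field, to a single transverse intersection in the level `V₁₊` between them
(Mazur: *"in `∂(S¹ × B⁴)` the attaching curve is isotopic to `S¹ × pt`"*; Milnor 1965, §8,
Lemma 8.3 and Thm. 8.4 with 5.8 and 4.7) — is spelled out in Lean as the hypothesis `hcan` of the
last two theorems (no named fact is minted, D-0026); it is the subject of the sequel files.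

* `IsMorseAdapted.exists_criticalSet_eq_triple_of_oneOneOne` — the critical data of a
  `(1,1,1)`-handlebody: three critical points `m, p, q` of indices `0, 1, 2`;
* `nonempty_diffeomorph_closedBall_of_isNiceMorseFunction_of_inter_eq_singleton` — **the
  cancellation**: if `g` is a nice Morse function on the triad `(V; ∅, ∂V)` of a compact
  `5`-manifold with boundary whose critical points are `m, p, q` of indices `0, 1, 2`, and for
  some gradient-like field the spheres `S_R(p)`, `S_L(q)` in `V₁₊ = g⁻¹(plusLevel 4 1)` meet in
  a single point, transversely, then `V ≅ 𝔻⁵` (Thm. 5.4 on the slab `g⁻¹[plusLevel 0, plusLevel 2]`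
  removes `p` and `q`; a compact manifold with boundary carrying an adapted Morse function with a
  single critical point, of index `0`, is the disc, Milnor 1963, Thm. 3.1);
* `nonempty_diffeomorph_closedBall_of_hasHandleDecomposition_oneOneOne_five_of_cancellingPosition`
  — a compact `5`-manifold with one handle of each index `0, 1, 2` whose `(1, 2)` pair can be put
  in cancelling position is the `5`-ball (rescale the adapted Morse function to the triad,
  Def. 3.1; make it nice, Thm. 4.8; cancel);
* `Mazur1961_double_sphere_four_of_cancellingPosition` — **Mazur's theorem from the cancelling
  position alone**: the counted thickening `V` of the double `P` of a Mazur manifold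
  (`exists_countedThickening_of_isDouble_holds`) is such a manifold, contractible, with
  `∂V ≅ P`; so `P ≅ ∂𝔻⁵ = S⁴`.

## References

* B. Mazur, *A note on some contractible 4-manifolds*, Ann. of Math. 73 (1961), 221–228,
  Theorem and Corollary 1. [Mazur1961]
* I. R. Aitchison, J. H. Rubinstein, *Fibered knots and involutions on homotopy spheres*, Contemp.
  Math. 35 (1984), Lemma 5.4. [AitchisonRubinstein1984]
* J. Milnor, *Lectures on the h-cobordism theorem*, notes by L. Siebenmann and J. Sondow,
  Princeton (1965): Def. 3.1, Thm. 4.8 and Def. 4.9 (PDF p. 25), Thm. 5.4 (PDF p. 27), §8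
  (PDF pp. 54–57). [MilnorHCobordism1965]
* J. Milnor, *Morse theory* (1963), Thm. 3.1. [Milnor1963]
-/

noncomputable section

open scoped Manifold ContDiff Topology ContinuousMap
open Set Function Filter

namespace Literature.Topology.FourManifolds

/-! ### The critical data of a `(1,1,1)`-handlebody -/

section CriticalData

variable {k : ℕ} {M : Type*} [TopologicalSpace M] [CompactSpace M]
  [ChartedSpace (EuclideanHalfSpace (k + 1)) M] [IsManifold (𝓡∂ (k + 1)) ∞ M]

/-- **The critical data of a `(1,1,1)`-handlebody.**  An adapted Morse function presenting a
handle decomposition with one handle of each index `0, 1, 2` and nothing else has exactly three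
critical points `m, p, q`, of indices `0, 1, 2` (finiteness of the critical set,
`IsMorse.finite_criticalSet_holds`, turns the counts into equalities of sets).
[cite: Milnor1963, Thms. 3.2 and 3.5] -/
theorem IsMorseAdapted.exists_criticalSet_eq_triple_of_oneOneOne {f : M → ℝ}
    (hf : IsMorseAdapted (𝓡∂ (k + 1)) f)
    (hcount : ∀ j, (criticalSetOfIndex (𝓡∂ (k + 1)) f j).ncard =
      (fun j => if j ≤ 2 then 1 else 0) j) :
    ∃ m p q : M, criticalSetOfIndex (𝓡∂ (k + 1)) f 0 = {m} ∧
      criticalSetOfIndex (𝓡∂ (k + 1)) f 1 = {p} ∧ criticalSetOfIndex (𝓡∂ (k + 1)) f 2 = {q} ∧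
      criticalSet (𝓡∂ (k + 1)) f = {m, p, q} := by
  have hfin : (criticalSet (𝓡∂ (k + 1)) f).Finite := IsMorse.finite_criticalSet_holds hf.isMorse
  have hfin' : ∀ j, (criticalSetOfIndex (𝓡∂ (k + 1)) f j).Finite := fun j =>
    hfin.subset (criticalSetOfIndex_subset _ f j)
  have h0 : (criticalSetOfIndex (𝓡∂ (k + 1)) f 0).ncard = 1 := by rw [hcount 0]; simp
  have h1 : (criticalSetOfIndex (𝓡∂ (k + 1)) f 1).ncard = 1 := by rw [hcount 1]; simp
  have h2 : (criticalSetOfIndex (𝓡∂ (k + 1)) f 2).ncard = 1 := by rw [hcount 2]; simp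
  have hj : ∀ j, 2 < j → criticalSetOfIndex (𝓡∂ (k + 1)) f j = ∅ := fun j hj2 => by
    rw [← Set.ncard_eq_zero (hfin' j), hcount j]
    simp [not_le.2 hj2]
  obtain ⟨m, hm⟩ := Set.ncard_eq_one.1 h0
  obtain ⟨p, hp⟩ := Set.ncard_eq_one.1 h1
  obtain ⟨q, hq⟩ := Set.ncard_eq_one.1 h2
  have hmmem : m ∈ criticalSetOfIndex (𝓡∂ (k + 1)) f 0 := by rw [hm]; exact mem_singleton m
  have hpmem : p ∈ criticalSetOfIndex (𝓡∂ (k + 1)) f 1 := by rw [hp]; exact mem_singleton p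
  have hqmem : q ∈ criticalSetOfIndex (𝓡∂ (k + 1)) f 2 := by rw [hq]; exact mem_singleton q
  refine ⟨m, p, q, hm, hp, hq, ?_⟩
  ext z
  simp only [mem_insert_iff, mem_singleton_iff, mem_criticalSet]
  constructor
  · intro hz
    have hzk : z ∈ criticalSetOfIndex (𝓡∂ (k + 1)) f (morseIndex (𝓡∂ (k + 1)) f z) := ⟨hz, rfl⟩
    rcases Nat.lt_or_ge 2 (morseIndex (𝓡∂ (k + 1)) f z) with hlt | hle
    · rw [hj _ hlt] at hzk; exact hzk.elim
    · interval_cases h : morseIndex (𝓡∂ (k + 1)) f z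
      · rw [hm] at hzk; exact Or.inl hzk
      · rw [hp] at hzk; exact Or.inr (Or.inl hzk)
      · rw [hq] at hzk; exact Or.inr (Or.inr hzk)
  · rintro (rfl | rfl | rfl)
    · exact hmmem.1
    · exact hpmem.1
    · exact hqmem.1

end CriticalData

/-! ### The cancellation of the `(1, 2)` pair (Milnor 1965, Thm. 5.4) and the disc theorem -/

section Cancel

variable {V : Type} [TopologicalSpace V] [T2Space V] [SecondCountableTopology V]
  [ChartedSpace (EuclideanHalfSpace (4 + 1)) V] [IsManifold (𝓡∂ (4 + 1)) ∞ V] [CompactSpace V]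

/-- **Mazur's cancellation, Morse form (Milnor 1965, Thm. 5.4 with Milnor 1963, Thm. 3.1).**
Let `g` be a nice Morse function on the triad `(V; ∅, ∂V)` of a compact `5`-manifold with
boundary whose critical points are `m, p, q`, of indices `0, 1, 2` (so at the levels
`niceLevel 4 0 < niceLevel 4 1 < niceLevel 4 2`), and let `ξ` be a smooth gradient-like field for
which the right-hand sphere of `p` and the left-hand sphere of `q` in the level
`V₁₊ = g⁻¹(plusLevel 4 1)` meet in a single point `x₀`, transversely.  Then `V ≅ 𝔻⁵`: the First
Cancellation Theorem on the slab `g⁻¹[plusLevel 4 0, plusLevel 4 2]`, whose critical points are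
exactly `p` and `q` (`Cobordism.Milnor1965_firstCancellation_slab_holds`), yields a Morse function
on the triad equal to `g` near `m` and without other critical points, i.e. an adapted Morse
function with a single critical point, of index `0`, and such a manifold is the disc
(`IsMorseAdapted.nonempty_diffeomorph_closedBall`).
[cite: MilnorHCobordism1965, Thm. 5.4 (PDF p. 27), applied on a slab as on PDF p. 54]
[cite: Milnor1963, Thm. 3.1] [cite: Mazur1961, Theorem (W × I ≅ I⁵), proof] -/
theorem nonempty_diffeomorph_closedBall_of_isNiceMorseFunction_of_inter_eq_singleton
    {g : V → ℝ} (hg : (Cobordism.ofBoundary 4 V).IsNiceMorseFunction g) {m p q : V}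
    (hcrit : criticalSet (𝓡∂ (4 + 1)) g = {m, p, q}) (hm : morseIndex (𝓡∂ (4 + 1)) g m = 0)
    (hp : morseIndex (𝓡∂ (4 + 1)) g p = 1) (hq : morseIndex (𝓡∂ (4 + 1)) g q = 2)
    (ξ : Cₛ^∞⟮𝓡∂ (4 + 1); EuclideanSpace ℝ (Fin (4 + 1)), (TangentSpace (𝓡∂ (4 + 1)) : V → Type)⟯)
    (hξ : IsGradientLike (𝓡∂ (4 + 1)) g ξ) {x₀ : V}
    (hx₀ : rightHandSphere (𝓡∂ (4 + 1)) g ξ p (Cobordism.plusLevel 4 1) ∩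
      leftHandSphere (𝓡∂ (4 + 1)) g ξ q (Cobordism.plusLevel 4 1) = {x₀})
    (htr : IsTransverseInLevel (𝓡∂ (4 + 1)) (g ⁻¹' {Cobordism.plusLevel 4 1})
      (rightHandSphere (𝓡∂ (4 + 1)) g ξ p (Cobordism.plusLevel 4 1))
      (leftHandSphere (𝓡∂ (4 + 1)) g ξ q (Cobordism.plusLevel 4 1)) x₀) :
    Nonempty (V ≃ₘ⟮𝓡∂ (4 + 1), 𝓡∂ (4 + 1)⟯
      Metric.closedBall (0 : EuclideanSpace ℝ (Fin (4 + 1))) 1) := by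
  haveI : CompactSpace ((𝓡∂ (4 + 1)).boundary V) := compactSpace_boundary 4 V
  -- levels
  have hLP : ∀ k, Cobordism.niceLevel 4 k < Cobordism.plusLevel 4 k := Cobordism.niceLevel_lt_plusLevel 4
  have hPL : ∀ k, Cobordism.plusLevel 4 k < Cobordism.niceLevel 4 (k + 1) :=
    Cobordism.plusLevel_lt_niceLevel_succ 4
  have h00 : Cobordism.niceLevel 4 0 < Cobordism.plusLevel 4 0 := hLP 0
  have h01 : Cobordism.plusLevel 4 0 < Cobordism.niceLevel 4 1 := hPL 0
  have h11 : Cobordism.niceLevel 4 1 < Cobordism.plusLevel 4 1 := hLP 1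
  have h12 : Cobordism.plusLevel 4 1 < Cobordism.niceLevel 4 2 := hPL 1
  have h22 : Cobordism.niceLevel 4 2 < Cobordism.plusLevel 4 2 := hLP 2
  have h23 : Cobordism.plusLevel 4 2 < Cobordism.niceLevel 4 3 := hPL 2
  have hL3 : Cobordism.niceLevel 4 3 < 1 := Cobordism.niceLevel_lt_one (by norm_num)
  have hP0 : 0 < Cobordism.plusLevel 4 0 := (Cobordism.niceLevel_pos 4 0).trans h00
  have hP21 : Cobordism.plusLevel 4 2 < 1 := h23.trans hL3
  -- values of the critical points
  have hval : ∀ z ∈ criticalSet (𝓡∂ (4 + 1)) g,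
      g z = Cobordism.niceLevel 4 (morseIndex (𝓡∂ (4 + 1)) g z) := fun z hz => hg.2 z hz
  have hmc : m ∈ criticalSet (𝓡∂ (4 + 1)) g := by rw [hcrit]; exact mem_insert m _
  have hpc : p ∈ criticalSet (𝓡∂ (4 + 1)) g := by rw [hcrit]; exact Or.inr (mem_insert p _)
  have hqc : q ∈ criticalSet (𝓡∂ (4 + 1)) g := by rw [hcrit]; exact Or.inr (Or.inr rfl)
  have hmval : g m = Cobordism.niceLevel 4 0 := by rw [hval m hmc, hm]
  have hpval : g p = Cobordism.niceLevel 4 1 := by rw [hval p hpc, hp]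
  have hqval : g q = Cobordism.niceLevel 4 2 := by rw [hval q hqc, hq]
  have hpk : p ∈ criticalSetOfIndex (𝓡∂ (4 + 1)) g 1 := ⟨hpc, hp⟩
  have hqk : q ∈ criticalSetOfIndex (𝓡∂ (4 + 1)) g (1 + 1) := ⟨hqc, hq⟩
  -- the critical points of the slab `[plusLevel 0, plusLevel 2]` are `p` and `q`
  have honly : ∀ z ∈ criticalSet (𝓡∂ (4 + 1)) g,
      g z ∈ Icc (Cobordism.plusLevel 4 0) (Cobordism.plusLevel 4 2) → z = p ∨ z = q := by
    intro z hz hzI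
    have hz' := hz
    rw [hcrit] at hz'
    rcases hz' with rfl | rfl | rfl
    · rw [hmval] at hzI; exact absurd hzI.1 (not_le.2 h00)
    · exact Or.inl rfl
    · exact Or.inr rfl
  ----------------------------------------------------------------------------------------------
  -- Thm. 5.4 on the slab `g⁻¹[plusLevel 0, plusLevel 2]`: cancel `p` against `q`
  ----------------------------------------------------------------------------------------------
  obtain ⟨g₃, ξ₃, hg₃, -, hnear₃, -, hslab₃⟩ :=
    Cobordism.Milnor1965_firstCancellation_slab_holds hg.1 ξ hξ hP0 hP21 hpk hqk
      (by rw [hpval]; exact h01) (by rw [hpval]; exact h11) (by rw [hqval]; exact h12)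
      (by rw [hqval]; exact h22) honly hx₀ htr
  -- bookkeeping: `g₃ = g` near `m`, and `m` is the only critical point of `g₃`
  have hnear₃' : ∀ z, g z ∉ Icc (Cobordism.plusLevel 4 0) (Cobordism.plusLevel 4 2) →
      g₃ =ᶠ[𝓝 z] g := fun z hz => by
    have hzS : z ∈ {z | g z ∉ Ioo (Cobordism.plusLevel 4 0) (Cobordism.plusLevel 4 2)} :=
      fun h => hz (Ioo_subset_Icc_self h)
    exact hnear₃.filter_mono (nhds_le_nhdsSet hzS)
  have hmI : g m ∉ Icc (Cobordism.plusLevel 4 0) (Cobordism.plusLevel 4 2) := fun h => by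
    rw [hmval] at h; exact absurd h.1 (not_le.2 h00)
  have hm₃ : g₃ =ᶠ[𝓝 m] g := hnear₃' m hmI
  have hcrit₃ : ∀ z, IsMCriticalPt (𝓡∂ (4 + 1)) g₃ z ↔ z = m := by
    intro z
    by_cases hzI : g z ∈ Icc (Cobordism.plusLevel 4 0) (Cobordism.plusLevel 4 2)
    · constructor
      · intro h; exact absurd h (hslab₃ z hzI).2
      · rintro rfl; exact absurd hzI hmI
    · have key : IsMCriticalPt (𝓡∂ (4 + 1)) g₃ z ↔ IsMCriticalPt (𝓡∂ (4 + 1)) g z :=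
        isMCriticalPt_congr_of_eventuallyEq (hnear₃' z hzI)
      rw [key]
      constructor
      · intro hz
        have hz' : z ∈ criticalSet (𝓡∂ (4 + 1)) g := hz
        rw [hcrit] at hz'
        rcases hz' with rfl | rfl | rfl
        · rfl
        · exact absurd ⟨by rw [hpval]; exact h01.le, by rw [hpval]; linarith⟩ hzI
        · exact absurd ⟨by rw [hqval]; linarith, by rw [hqval]; exact h22.le⟩ hzI
      · rintro rfl; exact hmc
  have hA₃ : IsMorseAdapted (𝓡∂ (4 + 1)) g₃ := hg₃.isMorseAdapted_ofBoundary
  have hm₃c : IsMCriticalPt (𝓡∂ (4 + 1)) g₃ m := (hcrit₃ m).2 rfl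
  have hm₃i : morseIndex (𝓡∂ (4 + 1)) g₃ m = 0 := (morseIndex_congr_of_eventuallyEq hm₃).trans hm
  exact IsMorseAdapted.nonempty_diffeomorph_closedBall (k := 4) (by norm_num) hA₃ hm₃c
    (fun z hz => (hcrit₃ z).1 hz) hm₃i

/-- **A compact `5`-manifold with one handle of each index `0, 1, 2` whose `(1, 2)` pair can be
put in cancelling position is the `5`-ball.**  The hypothesis `hcan` is the Morse form of
Mazur's *"in `∂(S¹ × B⁴)` the attaching curve of the 2-handle is isotopic to `S¹ × pt`"*
(Mazur 1961), i.e. of Milnor's treatment of an index-`1` point (Milnor 1965, §8: Lemma 8.3, the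
ideal circle meeting `S_R(p)` transversely in one point; Thm. 8.4 with its Remark and Thm. 5.8,
homotopic embedded circles in a `4`-manifold are ambient isotopic; Lemma 4.7, the isotopy is
realised by a change of the gradient-like field): for every nice Morse function on the triad
`(V; ∅, ∂V)` of a compact contractible `5`-manifold with boundary whose critical points are
three points of indices `0, 1, 2`, some smooth gradient-like field has the right-hand sphere of
the index-`1` point and the left-hand sphere of the index-`2` point meeting in the level `V₁₊`
in a single point, transversely.  Given it: rescale the adapted Morse function of the handle
decomposition to the triad (Milnor 1965, Def. 3.1, `IsMorseAdapted.exists_isMorseFunction_ofBoundary`),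
make it nice (Thm. 4.8, `Cobordism.Milnor1965_finalRearrangement_holds`), and cancel
(`nonempty_diffeomorph_closedBall_of_isNiceMorseFunction_of_inter_eq_singleton`).
[cite: Mazur1961, Theorem (W × I ≅ I⁵), proof] [cite: MilnorHCobordism1965, Def. 3.1, Thm. 4.8 (PDF p. 25), Thm. 5.4 (PDF p. 27), §8 (PDF pp. 54–57)] -/
theorem nonempty_diffeomorph_closedBall_of_hasHandleDecomposition_oneOneOne_five_of_cancellingPosition
    (hcan : ∀ (V : Type) [TopologicalSpace V] [T2Space V] [SecondCountableTopology V]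
      [ChartedSpace (EuclideanHalfSpace (4 + 1)) V] [IsManifold (𝓡∂ (4 + 1)) ∞ V] [CompactSpace V]
      [ContractibleSpace V] (g : V → ℝ), (Cobordism.ofBoundary 4 V).IsNiceMorseFunction g →
      ∀ (m p q : V), criticalSet (𝓡∂ (4 + 1)) g = {m, p, q} →
      morseIndex (𝓡∂ (4 + 1)) g m = 0 → morseIndex (𝓡∂ (4 + 1)) g p = 1 →
      morseIndex (𝓡∂ (4 + 1)) g q = 2 →
      ∃ (ξ : Cₛ^∞⟮𝓡∂ (4 + 1); EuclideanSpace ℝ (Fin (4 + 1)),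
          (TangentSpace (𝓡∂ (4 + 1)) : V → Type)⟯) (x₀ : V),
        IsGradientLike (𝓡∂ (4 + 1)) g ξ ∧
        rightHandSphere (𝓡∂ (4 + 1)) g ξ p (Cobordism.plusLevel 4 1) ∩
          leftHandSphere (𝓡∂ (4 + 1)) g ξ q (Cobordism.plusLevel 4 1) = {x₀} ∧
        IsTransverseInLevel (𝓡∂ (4 + 1)) (g ⁻¹' {Cobordism.plusLevel 4 1})
          (rightHandSphere (𝓡∂ (4 + 1)) g ξ p (Cobordism.plusLevel 4 1))
          (leftHandSphere (𝓡∂ (4 + 1)) g ξ q (Cobordism.plusLevel 4 1)) x₀)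
    (W : Type) [TopologicalSpace W] [T2Space W] [SecondCountableTopology W]
    [ChartedSpace (EuclideanHalfSpace (4 + 1)) W] [IsManifold (𝓡∂ (4 + 1)) ∞ W] [CompactSpace W]
    [ContractibleSpace W] (hW : HasHandleDecomposition 4 W (fun k => if k ≤ 2 then 1 else 0)) :
    Nonempty (W ≃ₘ⟮𝓡∂ (4 + 1), 𝓡∂ (4 + 1)⟯
      Metric.closedBall (0 : EuclideanSpace ℝ (Fin (4 + 1))) 1) := by
  haveI : CompactSpace ((𝓡∂ (4 + 1)).boundary W) := compactSpace_boundary 4 W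
  obtain ⟨f, hf, hcount⟩ := hW
  obtain ⟨m, p, q, hf0, hf1, hf2, hfcrit⟩ := hf.exists_criticalSet_eq_triple_of_oneOneOne hcount
  -- Step 1: rescale `f` into Milnor's normalisation on the triad `(W; ∅, ∂W)`
  obtain ⟨s, -, hF, hSf⟩ := hf.exists_isMorseFunction_ofBoundary
  -- Step 2: Milnor's Thm. 4.8 on the triad: a nice Morse function `g`
  obtain ⟨g, hg, hcrit, hind⟩ := Cobordism.Milnor1965_finalRearrangement_holds hF
  have hSg : ∀ k, criticalSetOfIndex (𝓡∂ (4 + 1)) g k = criticalSetOfIndex (𝓡∂ (4 + 1)) f k :=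
    fun k => (criticalSetOfIndex_congr hcrit hind k).trans (hSf k)
  have hmk : m ∈ criticalSetOfIndex (𝓡∂ (4 + 1)) g 0 := by rw [hSg 0, hf0]; exact mem_singleton m
  have hpk : p ∈ criticalSetOfIndex (𝓡∂ (4 + 1)) g 1 := by rw [hSg 1, hf1]; exact mem_singleton p
  have hqk : q ∈ criticalSetOfIndex (𝓡∂ (4 + 1)) g 2 := by rw [hSg 2, hf2]; exact mem_singleton q
  have hgcrit : criticalSet (𝓡∂ (4 + 1)) g = {m, p, q} := by
    have hF' : criticalSet (𝓡∂ (4 + 1)) (fun y => s * f y + (1 - s)) = criticalSet (𝓡∂ (4 + 1)) f := by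
      rw [← iUnion_criticalSetOfIndex, ← iUnion_criticalSetOfIndex]
      exact iUnion_congr hSf
    exact hcrit.trans (hF'.trans hfcrit)
  -- Step 3: the cancelling position, Step 4: cancel
  obtain ⟨ξ, x₀, hξ, hx₀, htr⟩ := hcan W g hg m p q hgcrit hmk.2 hpk.2 hqk.2
  exact nonempty_diffeomorph_closedBall_of_isNiceMorseFunction_of_inter_eq_singleton hg hgcrit
    hmk.2 hpk.2 hqk.2 ξ hξ hx₀ htr

end Cancel

/-! ### Mazur's theorem from the cancelling position -/

/-- **Mazur's theorem (the double of a Mazur manifold is `S⁴`) from the cancelling position of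
the `(1, 2)` pair of the thickening** (Mazur 1961: `W × I ≅ B⁵` because its `1`- and `2`-handle
cancel, hence `2W = ∂(W × I) ≅ S⁴`; Aitchison–Rubinstein 1984, Lemma 5.4).  For a Mazur manifold
`W` (compact contractible, one handle of each index `0, 1, 2`) and a double `P` of `W`, the
counted thickening `V` (`exists_countedThickening_of_isDouble_holds`: `V = {f + s² ≤ 1 - ε} ⊂
Int W × ℝ`, the tree's `W × I`) is a compact contractible `5`-manifold with one handle of each
index `0, 1, 2` and `∂V ≅ P`; under the hypothesis `hcan` (the cancelling position, see
`nonempty_diffeomorph_closedBall_of_hasHandleDecomposition_oneOneOne_five_of_cancellingPosition`)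
it is the `5`-ball, and the boundary datum restricts the diffeomorphism to `P ≅ S⁴`.
[cite: Mazur1961, Theorem (W × I ≅ I⁵) and its Corollary (2W ≅ S⁴)] [cite: AitchisonRubinstein1984, Lemma 5.4] -/
theorem Mazur1961_double_sphere_four_of_cancellingPosition
    (hcan : ∀ (V : Type) [TopologicalSpace V] [T2Space V] [SecondCountableTopology V]
      [ChartedSpace (EuclideanHalfSpace (4 + 1)) V] [IsManifold (𝓡∂ (4 + 1)) ∞ V] [CompactSpace V]
      [ContractibleSpace V] (g : V → ℝ), (Cobordism.ofBoundary 4 V).IsNiceMorseFunction g →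
      ∀ (m p q : V), criticalSet (𝓡∂ (4 + 1)) g = {m, p, q} →
      morseIndex (𝓡∂ (4 + 1)) g m = 0 → morseIndex (𝓡∂ (4 + 1)) g p = 1 →
      morseIndex (𝓡∂ (4 + 1)) g q = 2 →
      ∃ (ξ : Cₛ^∞⟮𝓡∂ (4 + 1); EuclideanSpace ℝ (Fin (4 + 1)),
          (TangentSpace (𝓡∂ (4 + 1)) : V → Type)⟯) (x₀ : V),
        IsGradientLike (𝓡∂ (4 + 1)) g ξ ∧
        rightHandSphere (𝓡∂ (4 + 1)) g ξ p (Cobordism.plusLevel 4 1) ∩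
          leftHandSphere (𝓡∂ (4 + 1)) g ξ q (Cobordism.plusLevel 4 1) = {x₀} ∧
        IsTransverseInLevel (𝓡∂ (4 + 1)) (g ⁻¹' {Cobordism.plusLevel 4 1})
          (rightHandSphere (𝓡∂ (4 + 1)) g ξ p (Cobordism.plusLevel 4 1))
          (leftHandSphere (𝓡∂ (4 + 1)) g ξ q (Cobordism.plusLevel 4 1)) x₀) :
    Mazur1961_double_sphere_four := by
  intro W _ _ _ _ _ _ _ hW b P _ _ _ _ _ hD
  obtain ⟨V, _, _, _, _, _, _, ⟨e⟩, hVc, φ, hφ, hφr⟩ :=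
    exists_countedThickening_of_isDouble_holds 3 (fun k => if k ≤ 2 then 1 else 0) W hW b P hD
  haveI : ContractibleSpace V := e.contractibleSpace
  obtain ⟨Φ⟩ :=
    nonempty_diffeomorph_closedBall_of_hasHandleDecomposition_oneOneOne_five_of_cancellingPosition
      hcan V hVc
  let bP : BoundaryData (𝓡∂ (4 + 1)) V (𝓡 4) :=
    { carrier := P, incl := φ, isSmoothEmbedding := hφ, range_incl := hφr }
  exact ⟨bP.restrictDiffeomorph (closedBallBoundaryData 4) Φ⟩

end Literature.Topology.FourManifolds

end
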